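import Mathlib
import HarnessLib
import Literature.Analysis.FluidPDE.TypeIAncientMild
import Literature.Analysis.FluidPDE.TypeIAncientMildRescale
import Literature.Analysis.FluidPDE.PineauVicolRSS
import Literature.Analysis.FluidPDE.AxisymmetricVorticityTransport
import Literature.Analysis.FluidPDE.AxisymNoSwirlVorticity
import Summits.NavierStokesRegularity.NavierStokesRegularity.Theorems.CoriolisHeadCounterRotatingLiouville
import Summits.NavierStokesRegularity.NavierStokesRegularity.Theorems.TypeICertificateLadderTargetSolitonLawsProfile
import Summits.NavierStokesRegularity.NavierStokesRegularity.Theorems.AdaptedFrequencyTangentFlowTransferAncientPressure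
import Summits.NavierStokesRegularity.NavierStokesRegularity.Theorems.PoloidalWindowDoorPoloidalWindowRigidityNearIdentityDefs
import Summits.NavierStokesRegularity.NavierStokesRegularity.Theorems.PoloidalWindowDoorPoloidalWindowRigidityWindow

/-!
# Route `PoloidalWindowDoor`, crux `PoloidalWindowRigidity` (K2, stmt-NavierStokesRegularity-19708) + item `LrcModEntire` (20428) — THICK column, LINE 31 «zero_spin»
# (ns-idea-8 g14) KERNEL ANNEX PORTED: THE ZERO-SPIN LEVER — no e₂-POLOIDAL rotating scaling soliton in the Type-I ancient mild class; the column's research hand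
# H1 `NoPinnedScrewSoliton` IS A THEOREM

Seat ns-poloidal-K2-p2 g15 (port keyed by DIRECTOR-NS #314: «LINE 31 zero_spin: hand H1 PROVED in kernel annex — port to Theorems via K2-p2/LEAD if landable»;
`--supports stmt-NavierStokesRegularity-19708 --as helper`).  SOURCE AND AUTHORSHIP: `Cruxes/PoloidalWindowRigidity/Lines/zero_spin_kernel.lean` bfad73a16ef9 by the
IDEATOR ns-idea-8 g14 (lens «barrier») — statements and proofs VERBATIM except: the annex-local abbreviation `E₃` spelled out, `rotZ_smul_comm` private (tree copies),
`Pinned` / `Peakless` UNFOLDED VERBATIM in H1, `class_of_pinned` inlined, the route-file import `Theses.CoriolisHead` dropped (the consumed theorem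
`counterRotatingLiouville_proof` lives in `Theorems.CoriolisHeadCounterRotatingLiouville`, which is in that route's cone — `lint.theses-cone` noted).

THE ZERO-SPIN LEVER (ns-idea-8 g14).  A one-parameter vertical screw-scaling soliton `v(t,x) = λ R_{−ασ} v(λ²t, c + λR_{ασ}(x − c))`, `λ = e^σ`
(`IsScrewAbout c (ασ) (e^σ) v`, `…NearIdentityDefs`) is, in similarity variables, Pineau–Vicol's rotated self-similar ansatz (`Literature…pvAnsatz`) with the steady
profile `U = v(−1, c + ·)` and angular speed `−α/2` (`pvAnsatz_of_isScrew`); in the class `A_C` the profile is smooth, BOUNDED, divergence free and solves the rotated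
Leray system with a smooth pressure (`profileSystem_of_isScrew`, via `exists_isClassicalNSSolutionOn_Iio_of_isTypeIAncientMild` and `rss_profile_system`).  Route
`CoriolisHead` PROVED (`counterRotatingLiouville_proof`, stmt-22677) that a bounded smooth profile of `−νΔU + aU + aDU[y] + (BU − DU[By]) + DU[U] + ∇P = 0`, `B` skew,
is CONSTANT as soon as the Coriolis DEFECT `Σₗ (B ∂ₗU)ₗ ≥ 0`.  `defect_eq`: for the vertical frame `B = βJ` the defect is `−β (curl U)₂`, the SPIN VORTICITY — and the
column's profiles are e₂-POLOIDAL, so the defect VANISHES IDENTICALLY.  Hence `eq_zero_of_poloidal_screwSoliton` (ANY `α`, incl. `α = 0` = self-similar; any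
vertical axis; decay-free, pin-free) via constant profile ⇒ slice-constant soliton (`slice_const_of_isScrew`) ⇒ zero by the Oseen gauge
(`IsTypeIAncientMild.eq_zero_of_slice_const`); and H1 `noPinnedScrewSoliton`.

WHAT THIS IS NOT: not a claim about Navier–Stokes regularity — a support of a door route (bears_on LADDER-NS N0, rung N0-LocalTubeDoorPoloidal); the research cells of
LINES 30/31, crux 19708 / item 20428, ⟨27893⟩ OPEN; no summit statement is proved here.
-/

noncomputable section

-- the summit and its single sub-problem share the name (CONVENTIONS §1), as in every Theorems file
set_option linter.dupNamespace false

namespace Summit.NavierStokesRegularity.NavierStokesRegularity.Theorems.PoloidalWindowDoorPoloidalWindowRigidityZeroSpin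

open scoped RealInnerProductSpace InnerProductSpace BigOperators Laplacian
open Set Function Filter Topology
open Literature.Analysis Literature.Analysis.FluidPDE
open Summit.NavierStokesRegularity.NavierStokesRegularity.Theorems
open Summit.NavierStokesRegularity.NavierStokesRegularity.Theorems.PoloidalWindowDoorPoloidalWindowRigidityNearIdentityDefs

/-! ## §1 The Coriolis defect of the vertical frame is the vertical vorticity -/

/-- **`tr(αJ ∘ DU(y)) = −α (curl U)₂(y)`, coordinate form** — the Coriolis defect `Σₗ (B ∂ₗU)ₗ` of route `CoriolisHead` for the
vertical frame rate `B = α • J` (`J = rotGenL`, the generator of the rotations about the vertical axis, index `2`) is `−α` times the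
VERTICAL component of the vorticity (the SPIN VORTICITY of the frame, up to sign). -/
theorem defect_eq (α : ℝ) (U : (EuclideanSpace ℝ (Fin 3)) → (EuclideanSpace ℝ (Fin 3))) (y : (EuclideanSpace ℝ (Fin 3))) :
    ∑ l, ((α • rotGenL) (fderiv ℝ U y (EuclideanSpace.single l 1))) l = -(α * curl U y 2) := by
  rw [curl_apply_two]
  simp only [Fin.sum_univ_three, FunLike.coe_smul, Pi.smul_apply, rotGenL_apply, PiLp.smul_apply, smul_eq_mul,
    rotGen_apply_zero, rotGen_apply_one, rotGen_apply_two]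
  ring

/-- Hence it VANISHES for a field with no vertical vorticity (`⟪curl U, e₂⟫ ≡ 0`: the e₂-POLOIDAL class of the column). -/
theorem defect_eq_zero_of_poloidal (α : ℝ) {U : (EuclideanSpace ℝ (Fin 3)) → (EuclideanSpace ℝ (Fin 3))} (hpol : ∀ y, ⟪curl U y, EuclideanSpace.single 2 1⟫_ℝ = 0) (y : (EuclideanSpace ℝ (Fin 3))) :
    ∑ l, ((α • rotGenL) (fderiv ℝ U y (EuclideanSpace.single l 1))) l = 0 := by
  have h := hpol y
  rw [EuclideanSpace.inner_single_right] at h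
  simp only [one_mul, RCLike.conj_to_real] at h
  rw [defect_eq, h, mul_zero, neg_zero]

/-! ## §2 A screw-scaling soliton of the class is a rotated self-similar field with a bounded smooth profile solving the rotated Leray system -/

/-- `R_θ` commutes with scalars (private copy). -/
private theorem rotZ_smul_comm (θ c : ℝ) (x : (EuclideanSpace ℝ (Fin 3))) : rotZ θ (c • x) = c • rotZ θ x := by
  rw [← rotZL_apply, map_smul, rotZL_apply]

/-- The similarity time `σ(t) = log (√(−t))⁻¹` carries the slice `t` to the slice `−1`. -/
theorem exp_sigma {t : ℝ} (ht : t < 0) : Real.exp (Real.log (Real.sqrt (-t))⁻¹) = (Real.sqrt (-t))⁻¹ :=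
  Real.exp_log (inv_pos.2 (Real.sqrt_pos.2 (neg_pos.2 ht)))

/-- `(exp σ(t))² · t = −1` for the similarity time `σ(t) = log (√(−t))⁻¹`. -/
theorem exp_sigma_sq_mul {t : ℝ} (ht : t < 0) : Real.exp (Real.log (Real.sqrt (-t))⁻¹) ^ 2 * t = -1 := by
  rw [exp_sigma ht, inv_pow, Real.sq_sqrt (neg_pos.2 ht).le]
  field_simp [ht.ne]

/-- `log (√(−t))⁻¹ = −log(−t)/2`. -/
theorem sigma_eq {t : ℝ} (ht : t < 0) : Real.log (Real.sqrt (-t))⁻¹ = -(Real.log (-t) / 2) := by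
  rw [Real.log_inv, Real.log_sqrt (neg_pos.2 ht).le]

/-- **A vertical screw-scaling soliton IS Pineau–Vicol's rotated self-similar ansatz** with the steady profile `U = w(−1, ·)` and
angular speed `−α/2`: `w(t, x) = (−t)^{−1/2} R(−(α/2)(−log(−t))) U(R((α/2)(−log(−t)))ᵀ… )` — evaluate the soliton law
`IsScrew (ασ) (e^σ) w` at `σ = log (√(−t))⁻¹`. -/
theorem pvAnsatz_of_isScrew {α : ℝ} {w : ℝ → (EuclideanSpace ℝ (Fin 3)) → (EuclideanSpace ℝ (Fin 3))} (hsol : ∀ σ : ℝ, IsScrew (α * σ) (Real.exp σ) w) :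
    ∀ t < 0, ∀ x, w t x = pvAnsatz (-(α / 2)) (fun y _ => w (-1) y) t x := by
  intro t ht x
  have key := hsol (Real.log (Real.sqrt (-t))⁻¹) t ht x
  rw [exp_sigma_sq_mul ht, exp_sigma ht, sigma_eq ht] at key
  rw [key, pvAnsatz, rotZ_smul_comm]
  congr 2
  · ring
  · congr 2
    ring

/-- A soliton whose `t = −1` slice is constant is SLICE-CONSTANT at every past time. -/
theorem slice_const_of_isScrew {α : ℝ} {w : ℝ → (EuclideanSpace ℝ (Fin 3)) → (EuclideanSpace ℝ (Fin 3))} (hsol : ∀ σ : ℝ, IsScrew (α * σ) (Real.exp σ) w)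
    {b : (EuclideanSpace ℝ (Fin 3))} (hb : ∀ y, w (-1) y = b) :
    ∀ t < 0, ∀ x, w t x = (Real.sqrt (-t))⁻¹ • rotZ (-(α * Real.log (Real.sqrt (-t))⁻¹)) b := by
  intro t ht x
  have key := hsol (Real.log (Real.sqrt (-t))⁻¹) t ht x
  rw [exp_sigma_sq_mul ht, exp_sigma ht, hb] at key
  exact key

/-- The rotated profile system delivered by `rss_profile_system` (`α • (J U − DU[J y]) + ½U + ½DU[y] − ΔU + DU[U] + ∇P = 0`) in the
binders of route `CoriolisHead` (`ν = 1`, `a = ½`, `B = α • J`) — the five-line conversion of `CorkscrewProfile.Birth.rotatedProfile_eq_general`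
(re-proved: that module is not built on the farm snapshot). -/
theorem rotatedProfile_eq_general {α : ℝ} {U : (EuclideanSpace ℝ (Fin 3)) → (EuclideanSpace ℝ (Fin 3))} {P : (EuclideanSpace ℝ (Fin 3)) → ℝ}
    (heq : ∀ y : (EuclideanSpace ℝ (Fin 3)),
      α • (rotGen (U y) - fderiv ℝ U y (rotGen y)) + (1 / 2 : ℝ) • U y + (1 / 2 : ℝ) • fderiv ℝ U y y
        - Laplacian.laplacian U y + fderiv ℝ U y (U y) + gradient P y = 0)
    (y : (EuclideanSpace ℝ (Fin 3))) :
    -((1 : ℝ) • Laplacian.laplacian U y) + (1 / 2 : ℝ) • U y + (1 / 2 : ℝ) • fderiv ℝ U y y +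
      ((α • rotGenL) (U y) - fderiv ℝ U y ((α • rotGenL) y)) + convect U U y + gradient P y = 0 := by
  rw [← heq y]
  simp only [one_smul, FunLike.coe_smul, Pi.smul_apply, rotGenL_apply, map_smul, convect_apply]
  module

/-- **THE PROFILE SYSTEM OF A SOLITON OF THE CLASS (PROVED, tree bridges only).**  If `w ∈ A_C` (Type-I ancient mild, Oseen gauge) is a
one-parameter vertical screw-scaling soliton about the origin, `IsScrew (ασ) (e^σ) w` for all `σ`, then its slice `U = w(−1, ·)` is smooth,
BOUNDED (`‖U‖ ≤ C`), divergence free and solves, with a smooth pressure `P`, the ROTATED LERAY PROFILE SYSTEM of route `CoriolisHead` with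
`ν = 1`, `a = ½`, frame rate `B = −(α/2) • J`:
`−ΔU + ½U + ½DU[y] + (BU − DU[By]) + DU[U] + ∇P = 0`.
Chain: one smooth pressure on the past (`exists_isClassicalNSSolutionOn_Iio_of_isTypeIAncientMild`, KNSS §4) ↦ restriction to `[−1,0)` ↦
the ansatz (`pvAnsatz_of_isScrew`) ↦ `rss_profile_system` (route `TypeICertificateLadder`) ↦ `rotatedProfile_eq_general`. -/
theorem profileSystem_of_isScrew {C α : ℝ} {w : ℝ → (EuclideanSpace ℝ (Fin 3)) → (EuclideanSpace ℝ (Fin 3))} (hw : IsTypeIAncientMild C w)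
    (hsol : ∀ σ : ℝ, IsScrew (α * σ) (Real.exp σ) w) :
    ∃ P : (EuclideanSpace ℝ (Fin 3)) → ℝ, ContDiff ℝ (⊤ : ℕ∞) (w (-1)) ∧ ContDiff ℝ (⊤ : ℕ∞) P ∧ VectorCalculus.IsDivFree (w (-1)) ∧
      (∀ y, -((1 : ℝ) • Laplacian.laplacian (w (-1)) y) + (1 / 2 : ℝ) • w (-1) y + (1 / 2 : ℝ) • fderiv ℝ (w (-1)) y y +
          (((-(α / 2)) • rotGenL) (w (-1) y) - fderiv ℝ (w (-1)) y (((-(α / 2)) • rotGenL) y)) +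
          convect (w (-1)) (w (-1)) y + gradient P y = 0) ∧
      (∀ y, ‖w (-1) y‖ ≤ C) := by
  obtain ⟨q, hq⟩ := exists_isClassicalNSSolutionOn_Iio_of_isTypeIAncientMild hw
  have hIco : IsClassicalNSSolutionOn (Ico (-1) 0) 1 0 w q := hq.mono Ico_subset_Iio_self (uniqueDiffOn_Ico _ _)
  have hans : ∀ t ∈ Ico (-1 : ℝ) 0, ∀ x : (EuclideanSpace ℝ (Fin 3)), w t x = pvAnsatz (-(α / 2)) (fun y _ => w (-1) y) t x :=
    fun t ht x => pvAnsatz_of_isScrew hsol t ht.2 x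
  obtain ⟨P, hUs, hPs, hdiv, heq⟩ := rss_profile_system (-(α / 2)) w q (w (-1)) hIco hans
  refine ⟨P, hUs, hPs, hdiv, fun y => rotatedProfile_eq_general heq y, fun y => ?_⟩
  have h := hw.norm_le (show (-1 : ℝ) < 0 by norm_num) y
  rwa [neg_neg, Real.sqrt_one, div_one] at h

/-! ## §3 THE CLASS-LEVEL THEOREM: no POLOIDAL rotating scaling soliton in `A_C` — any angular speed (α = 0 included), any vertical axis -/

/-- **NO POLOIDAL SCREW-SCALING SOLITON IN THE CLASS (PROVED, 0 sorry).**  An element `v` of the Type-I ancient mild class `A_C` whose vorticity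
has no vertical component at any past time (`⟪curl v(s), e₂⟫ ≡ 0`, the column's e₂-POLOIDALITY) and which is a one-parameter vertical
screw-scaling soliton about the vertical axis through some centre `c` — `IsScrewAbout c (ασ) (e^σ) v` for every `σ`, ANY angular speed `α`
(`α = 0`: continuously self-similar) — vanishes on the past.

PROOF (the ZERO-SPIN LEVER).  The translate `w = v(·, · + c)` is in `A_C`, poloidal, and a soliton about the origin; by `profileSystem_of_isScrew` its
slice `U = w(−1)` is a smooth BOUNDED rotated Leray profile with frame rate `B = −(α/2)J`.  Route `CoriolisHead`'s Coriolis defect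
`Σₗ (B ∂ₗU)ₗ = tr(B∘DU) = (α/2)(curl U)₂` (`defect_eq`) is the vertical vorticity — IDENTICALLY ZERO here — so the defect is signed and the PROVED
crux `CounterRotatingLiouville` (stmt-22677, `counterRotatingLiouville_proof`: Tsai's head-pressure Liouville theorem in the rotating frame, any
rate, merely bounded profiles) makes `U ≡ b` constant; a soliton with a constant slice is slice-constant (`slice_const_of_isScrew`), and the Oseen
gauge kills slice-constant elements (`IsTypeIAncientMild.eq_zero_of_slice_const`, KNSS Remark 6.1). -/
theorem eq_zero_of_poloidal_screwSoliton {C α : ℝ} {v : ℝ → (EuclideanSpace ℝ (Fin 3)) → (EuclideanSpace ℝ (Fin 3))} {c : (EuclideanSpace ℝ (Fin 3))} (hcl : IsTypeIAncientMild C v)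
    (hpol : ∀ s < 0, ∀ y, ⟪curl (v s) y, EuclideanSpace.single 2 1⟫_ℝ = 0)
    (hsol : ∀ σ : ℝ, IsScrewAbout c (α * σ) (Real.exp σ) v) : ∀ t < 0, ∀ x, v t x = 0 := by
  set w : ℝ → (EuclideanSpace ℝ (Fin 3)) → (EuclideanSpace ℝ (Fin 3)) := fun t x => v t (x + c) with hw_def
  have hw : IsTypeIAncientMild C w := hcl.comp_add_right c
  have hsol' : ∀ σ : ℝ, IsScrew (α * σ) (Real.exp σ) w := hsol
  obtain ⟨P, hUs, hPs, hdiv, heq, hbd⟩ := profileSystem_of_isScrew hw hsol'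
  -- the profile is poloidal: the defect vanishes
  have hpolU : ∀ y, ⟪curl (w (-1)) y, EuclideanSpace.single 2 1⟫_ℝ = 0 := by
    intro y
    have e : curl (w (-1)) y = curl (v (-1)) (y + c) := by
      simp only [hw_def, curl, fderiv_comp_add_right]
    rw [e]
    exact hpol (-1) (by norm_num) (y + c)
  have hdef : ∀ y, 0 ≤ ∑ l, (((-(α / 2)) • rotGenL) (fderiv ℝ (w (-1)) y (EuclideanSpace.single l 1))) l :=
    fun y => (defect_eq_zero_of_poloidal (-(α / 2)) hpolU y).symm.le
  have hskew : ∀ x : (EuclideanSpace ℝ (Fin 3)), inner ℝ (((-(α / 2)) • rotGenL) x) x = 0 := fun x => by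
    simp [real_inner_smul_left, inner_rotGen_self]
  obtain ⟨b, hb⟩ := counterRotatingLiouville_proof 1 (1 / 2) one_pos (by norm_num) ((-(α / 2)) • rotGenL) (w (-1)) P hUs
    (contDiff_infty.1 hPs 2) hskew hdiv heq ⟨C, hbd⟩ hdef
  -- a soliton with a constant slice is slice-constant, and the gauge kills it
  have hslice := slice_const_of_isScrew hsol' hb
  intro t ht x
  have h0 := hw.eq_zero_of_slice_const (b := fun t => (Real.sqrt (-t))⁻¹ • rotZ (-(α * Real.log (Real.sqrt (-t))⁻¹)) b)
    hslice ht (x - c)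
  simpa [hw_def] using h0

/-! ## §4 THE COLUMN'S HAND H1 `NoPinnedScrewSoliton`, VERBATIM (LINE 29/30/31; `Pinned` / `Peakless` unfolded), IS A THEOREM -/

/-- **H1 IS A THEOREM (0 sorry)** — the body of LINE 29/30/31's `NoPinnedScrewSoliton` with the Cruxes-local `Pinned C v` / `Peakless v` UNFOLDED VERBATIM:
no pinned peakless profile is a one-parameter vertical screw-scaling soliton `(ασ, e^σ)_σ`, `α ≠ 0`, about any vertical axis.  Neither `Peakless` nor `α ≠ 0` nor
the pin inequalities are used: class + poloidality + the hot value `v₂(−1,0) ≠ 0` (`eq_zero_of_poloidal_screwSoliton`).  The line files discharge their stub by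
`exact noPinnedScrewSoliton` (their `NoPinnedScrewSoliton` unfolds to this statement). -/
theorem noPinnedScrewSoliton :
    ∀ (C α : ℝ), α ≠ 0 → ∀ (v : ℝ → EuclideanSpace ℝ (Fin 3) → EuclideanSpace ℝ (Fin 3)) (c : EuclideanSpace ℝ (Fin 3)),
      (Literature.Analysis.FluidPDE.HasTypeITimeDecay C v ∧
        ContinuousOn (Function.uncurry v) (Set.Iio (0 : ℝ) ×ˢ Set.univ) ∧
        (∀ s t : ℝ, s < t → t < 0 → ∀ x, v t x =
          Literature.Analysis.UnboundedOperators.heatExtension (v s) (t - s) x -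
            Literature.Analysis.FluidPDE.oseenDuhamel 1 s v v t x) ∧
        (∀ t < 0, Literature.Analysis.FluidPDE.VectorCalculus.IsDivFree (v t)) ∧
        (∀ s < 0, ∀ q, ⟪Literature.Analysis.FluidPDE.curl (v s) q, EuclideanSpace.single 2 1⟫_ℝ = 0) ∧
        v (-1) 0 2 ≠ 0 ∧ (∀ t < 0, ∀ x, Real.sqrt (-t) * |v t x 2| ≤ |v (-1) 0 2|) ∧
        (∀ h : EuclideanSpace ℝ (Fin 3), fderiv ℝ (v (-1)) 0 h 2 = 0) ∧
        (deriv (fun s => v s 0 2) (-1) = v (-1) 0 2 / 2 ∧ v (-1) 0 2 * (Δ (fun q => v (-1) q 2)) 0 ≤ 0)) →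
      (∀ (s z₀ σ M : ℝ) (K O : Set (EuclideanSpace ℝ (Fin 3))), s < 0 →
        ((σ = 1 ∨ σ = -1) ∧ IsCompact K ∧ K.Nonempty ∧ (∀ q ∈ K, q 2 = z₀ ∧ σ * v s q 2 = M) ∧
          IsOpen O ∧ K ⊆ O ∧ (∀ q ∈ O, q 2 = z₀ → σ * v s q 2 ≤ M) ∧
          (∀ q ∈ O, q 2 = z₀ → σ * v s q 2 = M → q ∈ K)) → False) →
      (∀ σ : ℝ, IsScrewAbout c (α * σ) (Real.exp σ) v) → False := by
  intro C α _ v c hP _ hsol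
  have hcl : IsTypeIAncientMild C v :=
    PoloidalWindowDoorPoloidalWindowRigidityWindow.isTypeIAncientMild_of_class hP.1 hP.2.1 hP.2.2.1 hP.2.2.2.1
  have h0 := eq_zero_of_poloidal_screwSoliton hcl hP.2.2.2.2.1 hsol (-1) (by norm_num) 0
  exact hP.2.2.2.2.2.1 (by rw [h0]; rfl)

end Summit.NavierStokesRegularity.NavierStokesRegularity.Theorems.PoloidalWindowDoorPoloidalWindowRigidityZeroSpin

end
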